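import Summits.ResolutionOfSingularities.ResolutionOfSingularities.Theorems.DeltaCutRefCertificates3
import HarnessLib

/-!
# DeltaCutGradeCertificates — decomp-res node «GradeCut (certificates)» (lens-6 g28, critic row 210 CLEARED), tree
file 1/5 of the node

Content VERBATIM from the decomp-res lens-6 g28 node's two certificate files
`HOME/decomp-res-lens-6/g28/GradeCutCertificates.lean` (pin 92912ba2, 486 l; §GCertificatesA: the REGISTRIES of G₀ =
`z³ + t⁴u²w²` and H = `z³ + (t²w − u²)⁴`, char 3) and `…/GradeCutCertificates2.lean` (pin 5886ffab, 822 l;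
§GCertificatesB/§GCertificatesC: G₀ DECIDED at g-height 2, every chart of every blow-up; `H_sing_axis`), companions
of `GradeCut.lean` 594c5539 = `Theorems/DeltaCutGrade*` / `DeltaCutGradeCells`; HOME =
run/shared/lean/pub/decomp-res: ring level only — each imports the landed `Theorems.DeltaCutRefCertificates3` (g27,
writer g13) + `HarnessLib`, uses `Rescue.BedZpeBinom4Centre.mul_mem_pow_add` by the explicit `open …
(mul_mem_pow_add)`; every declaration is new, namespace `…Theorems.DeltaCutClasses`, sections `GCertificatesA` /
`GCertificatesB` / `GCertificatesC` (`open MvPolynomial`, `variable {K : Type*} [Field K]`), no `private` helpers,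
no `def : Prop`.  Farm (lens + critic): rc 0 · 0 err · 0 warn · 0 sorry (`GradeCutCertificates.check.txt`,
`GradeCutCertificates2.check.txt`; probes `bc/ProbeCert.lean` HOME-only).  Critic: CRITIC-LEDGER row 210 «GradeCut»
CLEARED — (g1) registry first: every clause of «G₀ ∈ F-top at refined height 0» (`G0_top`, `G0_plane` / `G0_near_u`
/ `G0_line`, `G0_closure_not_prime`, `G0_sing_closure`, `G0_refFrozen_certificate`) and of H (`H_top`, `H_wild`,
`H_coords`, `H_plane`, `H_surface_singular`, `H_gFrozen_certificate`; Sing W = the w-axis `H_sing_axis`); (g6) G₀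
CERTIFIED DECIDED at g-height 2, EVERY chart of EVERY blow-up (`G0_A_chart_z_noTop`, `G0_A_charts`, level 1 / step 1
/ step 2, `G0_G2a_certificate` / `G0_G2b_certificate`).  Landing orders = NEXT-g29.md (320db171) §4 (B)/(C) + critic
rider INBOX 2026-08-31T11:01:55Z: `DeltaCutGradeCertificates` / `…2` / `…3` … = the two files as ONE linear chain
cut at the tree's 400-line cap at declaration boundaries (each part re-opens its section with the same `variable` /
`open` header; file B's header rides in part 1 as the lens header, file C's header verbatim as a module comment in
front of its first declaration); all VERBATIM, `--kind proof --supports stmt-ResolutionOfSingularities-26971`, no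
`maxHeartbeats`, the HOME-only dupNamespace-linter lines dropped.

The lens header, verbatim:

> # GradeCutCertificates — decomp-res node «GradeCut» (lens-6 g28, critic row 204 RE-GRANT clause): KERNEL CERTIFICATES
>
> REGISTRY FIRST (condition (i) of the re-grant clause of CRITIC-LEDGER row 204): TWO NEW INHABITANTS of g27's located residual
> `E1TopRefHeavy` of kind F-surface (`RefFrozen`: the refined separating run freezes at a level whose irregular reduced bad
> closure has dimension `≥ 2`; NO inhabitant was on record), at the polynomial level, ALL charts, level-generic, in the g23–g27
> certificate format and dictionary (file `DeltaCutSepCertificates`: (ord) `∃ s ∉ 𝔮, s·g ∈ 𝔮^m`; WILD = `3`-power form; NEAR =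
> transform `∈ 𝔫'³` with a generic cofactor; TAME = order-2 differential operator extracting `c·e`, `e` a regular
parameter; (L) Rees
> charts of coordinate linear centres `linChartSubst`; (R) coordinate linear subspaces (and disjoint unions of them)
are regular,
> `V(I ⊓ J)` with `I ⊓ J` not prime «at» a point of `V(I + J)` is not regular there; (E) étale-local coordinates) plus ONE new
> dictionary line: (R′) a HYPERSURFACE GERM `V(z, g) ⊆ V(z) ≅ 𝔸³` with `g ∈ 𝔫_c²` is NOT REGULAR at `c` (embedding
dimension `3 >
> 2`).  Coordinates `0 = z, 1 = t, 2 = u, 3 = w` (renamed per chart in the docstrings).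
>
> * G₀ := `z³ + t⁴·u²·w²` (char 3) — the F-top INHABITANT: refined run FROZEN at refined height `0` with bad closure `P ∪ L`,
>   `P = V(z,t)` a PLANE, `L = V(z,u,w)` a LINE, meeting at the origin only (`Sing = {0}`, a point: G₀ is NOT a cylinder over a
>   frozen curve configuration); SURFACE PART `= P`, REGULAR: G₀ lies in the sub-kind F-top stated in advance (INBOX pre-pricing
>   line 2026-08-31T10:11:35Z) and is CERTIFIED DECIDED under the g28 law `gRun` at g-height `2` (§GCertificatesB/C).
> * H := `z³ + (t²w − u²)⁴` (char 3) — the INHABITANT OF THE NAMED COMPLEMENT F-surf-sing: bad closure = the irreducible surface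
>   `W = V(z, t²w − u²)` (a Whitney umbrella), surface part `= W`, NOT regular at the origin (R′): `gRun` freezes at
g-height `0`.
>
> Provenance: HOME = run/shared/lean/pub/decomp-res, lens-6 g28 (unit decomp-res-lens-6-g28); companion of
`GradeCut.lean` (the law);
> `--supports stmt-ResolutionOfSingularities-26971`.  Namespace `…Theorems.DeltaCutClasses`, sections
`GCertificatesA` (this file:
> level `0` of G₀ and H), `GCertificatesB/C` (levels `1`, `2` of G₀).  Imports the landed
`Theorems.DeltaCutRefCertificates3` (g27,
> writer g13) + `HarnessLib`; uses `Rescue.BedZpeBinom4Centre.mul_mem_pow_add` by the explicit `open …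
(mul_mem_pow_add)` (g26 dedup
> ruling); every declaration is new, no `private` helpers, no `def`s.
>
> (Sources: Hironaka1967; CossartJannsenSaito2020 Def. 3.13 / Thm. 3.14, Ch. 8, Thm. 9.6; Hironaka1970;
CossartPiltant2019 Prop. 2.6;
> CossartPiltant2008 §2; Giraud1975; Hironaka2005; EGAIV4 §16–§18; StacksProject 0804 / 0BIQ / 031I / 039P / 00PD; Matsumura1987
> §28–§30; Kollar2007 Thm. 1.101.)

## This file

§GCertificatesA — THE REGISTRIES (g1): G₀ = `z³ + t⁴u²w²` ∈ F-top at refined height 0 (`G0_top`, `G0_plane`,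
`G0_near_u`, `G0_line`, `G0_closure_not_prime`, `G0_sing_closure`, … , `G0_refFrozen_certificate`) and H = `z³ +
(t²w − u²)⁴` ∈ F-surf-sing (`H_top`, `H_wild`, `H_coords`, `H_plane`, `H_surface_singular`,
`H_gFrozen_certificate`); then §GCertificatesB/C (file `GradeCutCertificates2.lean`): G₀ DECIDED at g-height 2 —
level 0 → 1 (`G0_A_chart_z_noTop`, `G0_A_charts`), level 1, step 1, step 2 (`G0_G2a_certificate` /
`G0_G2b_certificate`), `H_sing_axis`.  Cut by the 400-line cap into consecutive parts.  (The 400-line cap cuts this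
group into 5 files; this first part carries: `G0_top`, `G0_plane`, `G0_near_u`, `G0_line`, `G0_closure_not_prime`,
`G0_sing_closure`, `G0_refFrozen_certificate`.)

[WRITER NOTE (decomp-res writer g13): file split only (tree files ≤ 400 lines, cut at declaration boundaries; the
two lens files form one linear chain); namespace, the sections `GCertificatesA/B/C` with their `open MvPolynomial` /
`variable {K : Type*} [Field K]`, and every declaration exactly as in the lens (the HOME-only dupNamespace-linter
lines are dropped — the library sets it; `noncomputable section`, the file-level `open` lines, `universe u` and
`open …Rescue.BedZpeBinom4Centre (mul_mem_pow_add)` are replayed in every part).]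

(Sources: Hironaka1967; CossartJannsenSaito2020 Def. 3.13 / Thm. 3.14, Ch. 5–8; CossartPiltant2019 Prop. 2.6;
Giraud1975; EGAIV4 §16–§18; StacksProject 0804 / 0BIQ / 035A; Matsumura1987 §28–§31; Kollar2007 §3.)
-/

noncomputable section

open CategoryTheory CategoryTheory.Limits AlgebraicGeometry TopologicalSpace IsLocalRing
open Literature.AlgebraicGeometry.Resolution

universe u

open Summit.ResolutionOfSingularities.ResolutionOfSingularities.Theorems.Rescue.BedZpeBinom4Centre (mul_mem_pow_add)

namespace Summit.ResolutionOfSingularities.ResolutionOfSingularities.Theorems.DeltaCutClasses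

open Summit.ResolutionOfSingularities.ResolutionOfSingularities.Theorems.TwistCutClasses
open Summit.ResolutionOfSingularities.ResolutionOfSingularities.Theorems.LightCutClasses

section GCertificatesA

open MvPolynomial
variable {K : Type*} [Field K]

/-! ### §GCertificatesA — G₀ = `z³ + t⁴u²w²` FROZEN AT REFINED HEIGHT 0 WITH A REGULAR SURFACE PART; H = `z³ + (t²w − u²)⁴`
FROZEN WITH A SINGULAR SURFACE PART (char 3)

REFINED RUN OF G₀ = `(𝔸⁴_k, (z³ + t⁴u²w²), 3)`, `k` any field of characteristic `3` (letter binders of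
`WORTopRefHeavy 3` addressed
exactly as for P∞/C_ax/B_S/C×: `IsBase`: affine 4-space; `IsDatum 3`: `D_z^{(3)} G₀ = 1`; the three heaviness binders: the
origin is a closed WILD top point with a NEAR point which is BAD (`G0_plane`); `¬ RunTerminates`: level `0` of the canonical bad
run is INFINITE (all closed points of a plane and a line: g25 kind A); `¬ SepTerminates`, `¬ RefTerminates`: this section):
* (T) top locus `⊆ P ∪ L`, `P = V(z,t)`, `L = V(z,u,w)` (`G0_top`: a prime of order `≥ 3` contains `z` and (`t` or both `u, w`):
  `∂_u∂_u G₀ = 2t⁴w²`, `∂_w∂_w G₀ = 2t⁴u²`); `= P ∪ L` and EVERY closed point of both is WILD with a NEAR point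
(`G0_plane`: `G₀ ∈
  (z,t)³`, `u, w ∉ (z,t)` — a PLANE —, `t⁴u²w² ∈ (z,t)⁴` (3-power form at every point of `P`), chart `π = u − a` of the point
  blow-up at `c = (0,0,a,b) ∈ P`: `z'³ + π·t'⁴·H ∈ 𝔫'³` for EVERY cofactor `H` (`= (a+π)²(b+w'π)²`); `G0_line`: `G₀ ∈ (z,u,w)³`,
  `t ∉ (z,u,w)`, `t⁴u²w² ∈ (z,u,w)⁴`, chart `u` of the point blow-up at `c = (0,c₁,0,0) ∈ L`: `z'³ + u·H·w'² ∈ 𝔫'³` for EVERY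
  `H` (`= (c₁ + τ'u)⁴`)).  So bad₀ = ALL closed points of `P ∪ L`: NONEMPTY (and INFINITE: g25 kind A at level `0`).
* (F) the reduced closure `V((z,t) ⊓ (z,u,w)) = V(z, tu, tw)` of bad₀ is NOT REGULAR at the origin
(`G0_closure_not_prime`: `t·u ∈
  (z,t) ⊓ (z,u,w) ∌ t, u` — dictionary (R)) and NOT of dimension `≤ 1` (`P` is a plane: `u, w ∉ (z,t)`): g26's separating test
  FAILS (`¬ ClosureRegular`) and g27's curve test FAILS (`¬ DimLEOne`, so `¬ CurveFrozen`): `refHop = sep = stay` — `RefFrozen 3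
  ⟨(𝔸⁴, (G₀)), none⟩` at refined height `0` (the empty moving prefix): KIND F-surface INHABITED.
* (S) `Sing(V(z,tu,tw)) = P ∩ L = {0}` (`G0_sing_closure`: `(z,t) + (z,u,w) = 𝔫₀`; off the origin the closure is
locally the plane
  or the line, regular (R)) — a POINT, not a line: G₀ is not étale-locally a product `(frozen curve configuration) × 𝔸¹`
  (the critic's cylinder clause F-surface-eq = RefCut × 𝔸¹ does not cover it).
* (TOP) the SURFACE PART of the closure (the union of its irreducible components of dimension `≥ 2`) is `P = V(z,t)` — a
  coordinate plane, REGULAR (R): level `0` is `TopFrozen` for the g28 law, whose hop blows up `𝓘(P)` (§GCertificatesB).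
REFINED RUN OF H = `(𝔸⁴_k, (z³ + (t²w − u²)⁴), 3)`:
* (T) top locus `⊆ W := V(z, g)`, `g = t²w − u²` (`H_top`: `∂_w H = t²·g³`, `∂_u H = −2u·g³` times the unit `4`; if `g ∉ 𝔮` then
  `t, u ∈ 𝔮`, so `g ∈ 𝔮` — absurd); `H ∈ (z, g)³`, `g⁴ ∈ (z,g)⁴` (`H_wild`: 3-power form at EVERY point of `W`).
* (E′) ON `D(t)` THE MAP `(z,t,u,w) ↦ (z,t,u,g)` IS A COORDINATE CHANGE (`w = (g + u²)/t²`; `∂_w g = t²`: `H_jac`) and `H =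
  B(z,t,u,g)` with `B := z³ + g⁴` LITERALLY (`H_coords`: `aeval`); in the coordinates `(z,t,u,g)` the set `W ∩ D(t)` is the
  coordinate PLANE `V(z,g)` and `B` is B_S's level-1 plane germ: EVERY closed point of `W ∩ D(t)` is WILD with a NEAR point
  (`H_plane`: `B ∈ (z,g)³`, `t, u ∉ (z,g)`, `g⁴ ∈ (z,g)⁴`, chart `τ = t − c₁`: `z'³ + τ·g'⁴·H' ∈ 𝔫'³` for every `H'`).  So
  bad₀ ⊇ all closed points of `W ∩ D(t)`, whose closure is `W` (`W` is a hypersurface of `V(z) ≅ 𝔸³`, equidimensional `2`, and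
  `W ∩ V(t) = V(z,t,u)` is a line, nowhere dense in it), and bad₀ `⊆` top `⊆ W`: closure bad₀ `= W`, its own surface part.
* (R′) `W` is NOT REGULAR at the origin: `g ∈ 𝔫₀²` (`H_surface_singular`; `𝒪_{W,0} = k[t,u,w]_{(t,u,w)}/(g)` has embedding
  dimension `3 > 2 = dim`), and `W` is not of dimension `≤ 1` (`t, u ∉ (z, g)`): `¬ ClosureRegular`, `¬ DimLEOne`,
AND the surface
  part is IRREGULAR (`¬ TopFrozen`): the g28 hop is `refHop = stay` — H is `GFrozen` at g-height `0`: the named complement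
  F-surf-sing of F-top inside F-surface is INHABITED (the g28 carve is STRICT on both sides).
The level certificates: `G0_refFrozen_certificate`, `H_gFrozen_certificate`. ∎ -/

/-! #### G₀ — level R0 = G0: top locus, the plane, the line, the frozen closure, its singular point -/

/-- **G₀ — THE TOP LOCUS lies in `V(z,t) ∪ V(z,u,w)`**: a prime of order `≥ 3` contains `z`, and `t` or both `u` and `w`
(`∂_u∂_u G₀ = 2·t⁴w²`, `∂_w∂_w G₀ = 2·t⁴u²`; `z³ ∈ 𝔮`). [new; elementary] [folklore] -/
theorem G0_top [CharP K 3] (𝔮 : Ideal (MvPolynomial (Fin 4) K)) [𝔮.IsPrime] {s : MvPolynomial (Fin 4) K} (hs : s ∉ 𝔮)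
    (h : s * (X 0 ^ 3 + X 1 ^ 4 * X 2 ^ 2 * X 3 ^ 2 : MvPolynomial (Fin 4) K) ∈ 𝔮 ^ 3) :
    (X 0 : MvPolynomial (Fin 4) K) ∈ 𝔮 ∧
      ((X 1 : MvPolynomial (Fin 4) K) ∈ 𝔮 ∨ ((X 2 : MvPolynomial (Fin 4) K) ∈ 𝔮 ∧ (X 3 : MvPolynomial (Fin 4) K) ∈ 𝔮)) := by
  have hs2 : s ^ 2 ∉ 𝔮 := pow_not_mem 𝔮 hs 2
  have hs4 : (s ^ 2) ^ 2 ∉ 𝔮 := pow_not_mem 𝔮 hs2 2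
  have h2 : (2 : MvPolynomial (Fin 4) K) ∉ 𝔮 := by
    have := natCast_not_mem (K := K) 𝔮 (m := 2) (by decide)
    exact_mod_cast this
  have e20 := f_ne K (i := 2) (j := 0) (by decide)
  have e21 := f_ne K (i := 2) (j := 1) (by decide)
  have e23 := f_ne K (i := 2) (j := 3) (by decide)
  have e22 := f_self K 2
  have e30 := f_ne K (i := 3) (j := 0) (by decide)
  have e31 := f_ne K (i := 3) (j := 1) (by decide)
  have e32 := f_ne K (i := 3) (j := 2) (by decide)
  have e33 := f_self K 3
  have d2 : pderiv 2 (X 0 ^ 3 + X 1 ^ 4 * X 2 ^ 2 * X 3 ^ 2 : MvPolynomial (Fin 4) K) = 2 * (X 1 ^ 4 * X 2 * X 3 ^ 2) := by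
    simp only [map_add, Derivation.leibniz, Derivation.leibniz_pow, smul_eq_mul, nsmul_eq_mul, e20, e21, e22, e23]
    push_cast; ring
  have dd2 : pderiv 2 (2 * (X 1 ^ 4 * X 2 * X 3 ^ 2) : MvPolynomial (Fin 4) K) = 2 * (X 1 ^ 4 * X 3 ^ 2) ^ 1 := by
    simp only [Derivation.leibniz, Derivation.leibniz_pow, smul_eq_mul, nsmul_eq_mul, e21, e22, e23, f_two]
    push_cast; ring
  have d3 : pderiv 3 (X 0 ^ 3 + X 1 ^ 4 * X 2 ^ 2 * X 3 ^ 2 : MvPolynomial (Fin 4) K) = 2 * (X 1 ^ 4 * X 2 ^ 2 * X 3) := by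
    simp only [map_add, Derivation.leibniz, Derivation.leibniz_pow, smul_eq_mul, nsmul_eq_mul, e30, e31, e32, e33]
    push_cast; ring
  have dd3 : pderiv 3 (2 * (X 1 ^ 4 * X 2 ^ 2 * X 3) : MvPolynomial (Fin 4) K) = 2 * (X 1 ^ 4 * X 2 ^ 2) ^ 1 := by
    simp only [Derivation.leibniz, Derivation.leibniz_pow, smul_eq_mul, nsmul_eq_mul, e31, e32, e33, f_two]
    push_cast; ring
  have h12 := sq_mul_deriv_mem_pow 𝔮 h (pderiv 2)
  rw [d2] at h12
  have h22 := sq_mul_deriv_mem_pow 𝔮 h12 (pderiv 2)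
  rw [dd2] at h22
  have hA : (X 1 ^ 4 * X 3 ^ 2 : MvPolynomial (Fin 4) K) ∈ 𝔮 := mem_of_mul_mul_pow_mem_pow 𝔮 one_ne_zero hs4 h2 h22
  have h13 := sq_mul_deriv_mem_pow 𝔮 h (pderiv 3)
  rw [d3] at h13
  have h33 := sq_mul_deriv_mem_pow 𝔮 h13 (pderiv 3)
  rw [dd3] at h33
  have hB : (X 1 ^ 4 * X 2 ^ 2 : MvPolynomial (Fin 4) K) ∈ 𝔮 := mem_of_mul_mul_pow_mem_pow 𝔮 one_ne_zero hs4 h2 h33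
  have hP := ‹𝔮.IsPrime›
  have h1or : (X 1 : MvPolynomial (Fin 4) K) ∈ 𝔮 ∨
      ((X 2 : MvPolynomial (Fin 4) K) ∈ 𝔮 ∧ (X 3 : MvPolynomial (Fin 4) K) ∈ 𝔮) := by
    rcases hP.mem_or_mem hA with hA | hA
    · exact Or.inl (hP.mem_of_pow_mem 4 hA)
    rcases hP.mem_or_mem hB with hB | hB
    · exact Or.inl (hP.mem_of_pow_mem 4 hB)
    exact Or.inr ⟨hP.mem_of_pow_mem 2 hB, hP.mem_of_pow_mem 2 hA⟩
  have hf : (X 0 ^ 3 + X 1 ^ 4 * X 2 ^ 2 * X 3 ^ 2 : MvPolynomial (Fin 4) K) ∈ 𝔮 := mem_of_sMul_mem_cube 𝔮 hs h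
  have hr : (X 1 ^ 4 * X 2 ^ 2 * X 3 ^ 2 : MvPolynomial (Fin 4) K) ∈ 𝔮 := by
    rcases h1or with h1 | ⟨hu, _⟩
    · exact Ideal.mul_mem_right _ _ (Ideal.mul_mem_right _ _ (Ideal.pow_mem_of_mem 𝔮 h1 4 (by norm_num)))
    · exact Ideal.mul_mem_right _ _ (Ideal.mul_mem_left _ _ (Ideal.pow_mem_of_mem 𝔮 hu 2 (by norm_num)))
  have h0 : (X 0 : MvPolynomial (Fin 4) K) ^ 3 ∈ 𝔮 := by
    have := Ideal.sub_mem _ hf hr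
    rwa [add_sub_cancel_right] at this
  exact ⟨hP.mem_of_pow_mem 3 h0, h1or⟩

/-- **G₀ — THE PLANE `P = V(z,t)` lies in the top locus** (`G₀ ∈ P³`), is a PLANE (`u, w ∉ P`), is WILD at every point (`t⁴u²w²
∈ P⁴`: the 3-power form `z³ + P⁴`), and every closed point `c = (0,0,a,b)` of it has a NEAR point (chart `π = u − a`
of the point
blow-up at `c`: the transform `z'³ + π·t'⁴·H`, `H = (a+π)²(b+w'π)²`, lies in `𝔫'³` for EVERY cofactor `H`): bad₀ `⊇` all closed
points of `P`. [new; elementary] [folklore] -/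
theorem G0_plane :
    (X 0 ^ 3 + X 1 ^ 4 * X 2 ^ 2 * X 3 ^ 2 : MvPolynomial (Fin 4) K) ∈ (Ideal.span {(X 0 : MvPolynomial (Fin 4) K), X 1}) ^ 3 ∧
      ((X 2 : MvPolynomial (Fin 4) K) ∉ Ideal.span {(X 0 : MvPolynomial (Fin 4) K), X 1} ∧
        (X 3 : MvPolynomial (Fin 4) K) ∉ Ideal.span {(X 0 : MvPolynomial (Fin 4) K), X 1}) ∧
      (X 1 ^ 4 * X 2 ^ 2 * X 3 ^ 2 : MvPolynomial (Fin 4) K) ∈ (Ideal.span {(X 0 : MvPolynomial (Fin 4) K), X 1}) ^ 4 ∧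
      ∀ H : MvPolynomial (Fin 4) K, (X 0 ^ 3 + X 2 * (X 1 ^ 4 * H) : MvPolynomial (Fin 4) K) ∈
        (Ideal.span {(X 0 : MvPolynomial (Fin 4) K), X 1, X 2, X 3}) ^ 3 := by
  have hX0 : (X 0 : MvPolynomial (Fin 4) K) ∈ Ideal.span {(X 0 : MvPolynomial (Fin 4) K), X 1} := Ideal.subset_span (by simp)
  have hX1 : (X 1 : MvPolynomial (Fin 4) K) ∈ Ideal.span {(X 0 : MvPolynomial (Fin 4) K), X 1} := Ideal.subset_span (by simp)
  have hr : (X 1 ^ 4 * X 2 ^ 2 * X 3 ^ 2 : MvPolynomial (Fin 4) K) ∈ (Ideal.span {(X 0 : MvPolynomial (Fin 4) K), X 1}) ^ 4 :=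
    Ideal.mul_mem_right _ _ (Ideal.mul_mem_right _ _ (Ideal.pow_mem_pow hX1 4))
  refine ⟨Ideal.add_mem _ (Ideal.pow_mem_pow hX0 3) (Ideal.pow_le_pow_right (by norm_num) hr), ⟨?_, ?_⟩, hr, fun H => ?_⟩
  · refine not_mem_span_of_eval _ (fun i => if i = 2 then 1 else 0) ?_ (by simp)
    intro g hg
    simp only [Set.mem_insert_iff, Set.mem_singleton_iff] at hg
    rcases hg with rfl | rfl <;> simp
  · refine not_mem_span_of_eval _ (fun i => if i = 3 then 1 else 0) ?_ (by simp)
    intro g hg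
    simp only [Set.mem_insert_iff, Set.mem_singleton_iff] at hg
    rcases hg with rfl | rfl <;> simp
  · refine Ideal.add_mem _ (Ideal.pow_mem_pow (X_mem_spanX4 0) 3) ?_
    have h5 : (X 2 * X 1 ^ 4 : MvPolynomial (Fin 4) K) ∈ (Ideal.span {(X 0 : MvPolynomial (Fin 4) K), X 1, X 2, X 3}) ^ (1 + 4) :=
      mul_mem_pow_add (by rw [pow_one]; exact X_mem_spanX4 2) (Ideal.pow_mem_pow (X_mem_spanX4 1) 4)
    have := Ideal.mul_mem_right H _ (Ideal.pow_le_pow_right (show 3 ≤ 1 + 4 by norm_num) h5)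
    rwa [show (X 2 * X 1 ^ 4 * H : MvPolynomial (Fin 4) K) = X 2 * (X 1 ^ 4 * H) by ring] at this

/-- **THE NEAR-POINT SENTENCE ALONG A `t`-LINE `V(z,u,w)`** (shared by G₀'s line `L` at level `0` and its strict
transform `L₁` at
level `1`): chart `u` of the point blow-up at `c = (0, c₁, 0, 0)` turns `z³ + Φ(t)·u²w²` (`Φ = t⁴`, resp. `t`) into `u³·(z'³ +
u·H·w'²)`, `H = Φ(c₁ + τ'u)`, and `z'³ + u·H·w'² ∈ 𝔫'³` for EVERY cofactor `H`. [new; elementary] [folklore] -/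
theorem G0_near_u (H : MvPolynomial (Fin 4) K) :
    (X 0 ^ 3 + X 2 * (H * X 3 ^ 2) : MvPolynomial (Fin 4) K) ∈ (Ideal.span {(X 0 : MvPolynomial (Fin 4) K), X 1, X 2, X 3}) ^ 3 := by
  refine Ideal.add_mem _ (Ideal.pow_mem_pow (X_mem_spanX4 0) 3) ?_
  have h3 : (X 2 * X 3 ^ 2 : MvPolynomial (Fin 4) K) ∈ (Ideal.span {(X 0 : MvPolynomial (Fin 4) K), X 1, X 2, X 3}) ^ (1 + 2) :=
    mul_mem_pow_add (by rw [pow_one]; exact X_mem_spanX4 2) (Ideal.pow_mem_pow (X_mem_spanX4 3) 2)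
  have := Ideal.mul_mem_left _ H h3
  rwa [show (H * (X 2 * X 3 ^ 2) : MvPolynomial (Fin 4) K) = X 2 * (H * X 3 ^ 2) by ring] at this

/-- **G₀ — THE LINE `L = V(z,u,w)` lies in the top locus** (`G₀ ∈ L³`), is a LINE (`t ∉ L`), is WILD at every point (`t⁴u²w² ∈
L⁴`), and every closed point of it has a NEAR point (`G0_near_u` with `H = (c₁ + τ'u)⁴`): bad₀ `⊇` all closed points of `L`.
[new; elementary] [folklore] -/
theorem G0_line :
    (X 0 ^ 3 + X 1 ^ 4 * X 2 ^ 2 * X 3 ^ 2 : MvPolynomial (Fin 4) K) ∈ (Ideal.span {(X 0 : MvPolynomial (Fin 4) K), X 2, X 3}) ^ 3 ∧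
      (X 1 : MvPolynomial (Fin 4) K) ∉ Ideal.span {(X 0 : MvPolynomial (Fin 4) K), X 2, X 3} ∧
      (X 1 ^ 4 * X 2 ^ 2 * X 3 ^ 2 : MvPolynomial (Fin 4) K) ∈ (Ideal.span {(X 0 : MvPolynomial (Fin 4) K), X 2, X 3}) ^ 4 ∧
      ∀ H : MvPolynomial (Fin 4) K, (X 0 ^ 3 + X 2 * (H * X 3 ^ 2) : MvPolynomial (Fin 4) K) ∈
        (Ideal.span {(X 0 : MvPolynomial (Fin 4) K), X 1, X 2, X 3}) ^ 3 := by
  have hX0 : (X 0 : MvPolynomial (Fin 4) K) ∈ Ideal.span {(X 0 : MvPolynomial (Fin 4) K), X 2, X 3} := Ideal.subset_span (by simp)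
  have hX2 : (X 2 : MvPolynomial (Fin 4) K) ∈ Ideal.span {(X 0 : MvPolynomial (Fin 4) K), X 2, X 3} := Ideal.subset_span (by simp)
  have hX3 : (X 3 : MvPolynomial (Fin 4) K) ∈ Ideal.span {(X 0 : MvPolynomial (Fin 4) K), X 2, X 3} := Ideal.subset_span (by simp)
  have h22 : (X 2 ^ 2 * X 3 ^ 2 : MvPolynomial (Fin 4) K) ∈ (Ideal.span {(X 0 : MvPolynomial (Fin 4) K), X 2, X 3}) ^ (2 + 2) :=
    mul_mem_pow_add (Ideal.pow_mem_pow hX2 2) (Ideal.pow_mem_pow hX3 2)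
  have hr : (X 1 ^ 4 * X 2 ^ 2 * X 3 ^ 2 : MvPolynomial (Fin 4) K) ∈ (Ideal.span {(X 0 : MvPolynomial (Fin 4) K), X 2, X 3}) ^ 4 := by
    have := Ideal.mul_mem_left _ (X 1 ^ 4) h22
    rwa [show (X 1 ^ 4 * (X 2 ^ 2 * X 3 ^ 2) : MvPolynomial (Fin 4) K) = X 1 ^ 4 * X 2 ^ 2 * X 3 ^ 2 by ring] at this
  refine ⟨Ideal.add_mem _ (Ideal.pow_mem_pow hX0 3) (Ideal.pow_le_pow_right (by norm_num) hr), ?_, hr, G0_near_u⟩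
  refine not_mem_span_of_eval _ (fun i => if i = 1 then 1 else 0) ?_ (by simp)
  intro g hg
  simp only [Set.mem_insert_iff, Set.mem_singleton_iff] at hg
  rcases hg with rfl | rfl | rfl <;> simp

/-- **G₀ — THE REDUCED CLOSURE `V((z,t) ⊓ (z,u,w))` OF bad₀ IS NOT REGULAR at the origin**: the radical ideal `(z,t) ⊓ (z,u,w)`
of `P ∪ L` is NOT PRIME «at the origin» — `t·u ∈ (z,t) ⊓ (z,u,w)` while `t, u ∉ (z,t) ⊓ (z,u,w)`, and `t, u ∈ 𝔫₀ ⊇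
(z,t) + (z,u,w)`
— so the local ring of the closure at the origin is not a domain, hence not regular (dictionary (R)): `¬ ClosureRegular` at
level `0`. [new; elementary] [folklore] -/
theorem G0_closure_not_prime :
    (X 1 * X 2 : MvPolynomial (Fin 4) K) ∈
        Ideal.span {(X 0 : MvPolynomial (Fin 4) K), X 1} ⊓ Ideal.span {(X 0 : MvPolynomial (Fin 4) K), X 2, X 3} ∧
      (X 1 : MvPolynomial (Fin 4) K) ∉
        Ideal.span {(X 0 : MvPolynomial (Fin 4) K), X 1} ⊓ Ideal.span {(X 0 : MvPolynomial (Fin 4) K), X 2, X 3} ∧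
      (X 2 : MvPolynomial (Fin 4) K) ∉
        Ideal.span {(X 0 : MvPolynomial (Fin 4) K), X 1} ⊓ Ideal.span {(X 0 : MvPolynomial (Fin 4) K), X 2, X 3} := by
  have hP1 : (X 1 : MvPolynomial (Fin 4) K) ∈ Ideal.span {(X 0 : MvPolynomial (Fin 4) K), X 1} := Ideal.subset_span (by simp)
  have hL2 : (X 2 : MvPolynomial (Fin 4) K) ∈ Ideal.span {(X 0 : MvPolynomial (Fin 4) K), X 2, X 3} := Ideal.subset_span (by simp)
  refine ⟨Ideal.mem_inf.2 ⟨Ideal.mul_mem_right _ _ hP1, Ideal.mul_mem_left _ _ hL2⟩, fun h1 => ?_, fun h2 => ?_⟩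
  · refine not_mem_span_of_eval _ (fun i => if i = 1 then 1 else 0) ?_ (by simp) (Ideal.mem_inf.1 h1).2
    intro g hg
    simp only [Set.mem_insert_iff, Set.mem_singleton_iff] at hg
    rcases hg with rfl | rfl | rfl <;> simp
  · refine not_mem_span_of_eval _ (fun i => if i = 2 then 1 else 0) ?_ (by simp) (Ideal.mem_inf.1 h2).1
    intro g hg
    simp only [Set.mem_insert_iff, Set.mem_singleton_iff] at hg
    rcases hg with rfl | rfl <;> simp

/-- **G₀ — `Sing(closure bad₀) = P ∩ L = {origin}`**: the plane `P = V(z,t)` and the line `L = V(z,u,w)` (each regular (R)) meet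
EXACTLY at the origin: `(z,t) ⊔ (z,u,w) = 𝔫₀`.  So the singular locus of the frozen closure is a POINT — G₀ is not a
cylinder over
a frozen CURVE configuration (the critic's clause F-surface-eq); and the closure is NOT of dimension `≤ 1` (`P` is a plane,
`G0_plane`): `¬ DimLEOne`, so `¬ CurveFrozen` — g27's refined hop is the (inactive) separating hop: FROZEN. [new; elementary]
[folklore] -/
theorem G0_sing_closure :
    Ideal.span {(X 0 : MvPolynomial (Fin 4) K), X 1} ⊔ Ideal.span {(X 0 : MvPolynomial (Fin 4) K), X 2, X 3} =
      Ideal.span {(X 0 : MvPolynomial (Fin 4) K), X 1, X 2, X 3} := by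
  apply le_antisymm
  · refine sup_le (Ideal.span_le.2 ?_) (Ideal.span_le.2 ?_)
    · intro g hg
      simp only [Set.mem_insert_iff, Set.mem_singleton_iff] at hg
      rcases hg with rfl | rfl
      exacts [X_mem_spanX4 0, X_mem_spanX4 1]
    · intro g hg
      simp only [Set.mem_insert_iff, Set.mem_singleton_iff] at hg
      rcases hg with rfl | rfl | rfl
      exacts [X_mem_spanX4 0, X_mem_spanX4 2, X_mem_spanX4 3]
  · refine Ideal.span_le.2 ?_
    intro g hg
    simp only [Set.mem_insert_iff, Set.mem_singleton_iff] at hg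
    rcases hg with rfl | rfl | rfl | rfl
    · exact Ideal.mem_sup_left (Ideal.subset_span (by simp))
    · exact Ideal.mem_sup_left (Ideal.subset_span (by simp))
    · exact Ideal.mem_sup_right (Ideal.subset_span (by simp))
    · exact Ideal.mem_sup_right (Ideal.subset_span (by simp))

/-- **G₀ — THE REFINED-FROZEN CERTIFICATE WITH A REGULAR SURFACE PART (`RefFrozen 3 ⟨(𝔸⁴, (G₀)), none⟩` at refined height `0`;
kind F-surface INHABITED; sub-kind F-top).**  (T) top locus `⊆ P ∪ L` (`G0_top`); (P)+(L) every closed point of the plane `P`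
and of the line `L` is WILD and δ-HEAVY (bad₀ = all closed points of `P ∪ L`: NONEMPTY, INFINITE); (F) the reduced
closure is NOT
REGULAR at the origin (`G0_closure_not_prime`) and NOT a curve (`u, w ∉ P`); (S) its singular locus is the single point `P ∩ L`
(`G0_sing_closure`); (TOP) its surface part `P` is a coordinate plane — REGULAR (R).  So: separating test FAILS, curve test
FAILS — `RefFrozen` with the empty moving prefix —, and the g28 test `TopFrozen` HOLDS: the g28 hop blows up `𝓘(P)`. [new]
[folklore] -/
theorem G0_refFrozen_certificate [CharP K 3] :
    -- (T) top ⊆ P ∪ L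
    (∀ (𝔮 : Ideal (MvPolynomial (Fin 4) K)) [𝔮.IsPrime], ∀ s ∉ 𝔮,
        s * (X 0 ^ 3 + X 1 ^ 4 * X 2 ^ 2 * X 3 ^ 2 : MvPolynomial (Fin 4) K) ∈ 𝔮 ^ 3 →
          (X 0 : MvPolynomial (Fin 4) K) ∈ 𝔮 ∧
            ((X 1 : MvPolynomial (Fin 4) K) ∈ 𝔮 ∨ ((X 2 : MvPolynomial (Fin 4) K) ∈ 𝔮 ∧ (X 3 : MvPolynomial (Fin 4) K) ∈ 𝔮))) ∧
    -- (P) the plane: top, plane, wild, near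
      ((X 0 ^ 3 + X 1 ^ 4 * X 2 ^ 2 * X 3 ^ 2 : MvPolynomial (Fin 4) K) ∈ (Ideal.span {(X 0 : MvPolynomial (Fin 4) K), X 1}) ^ 3 ∧
        ((X 2 : MvPolynomial (Fin 4) K) ∉ Ideal.span {(X 0 : MvPolynomial (Fin 4) K), X 1} ∧
          (X 3 : MvPolynomial (Fin 4) K) ∉ Ideal.span {(X 0 : MvPolynomial (Fin 4) K), X 1}) ∧
        (X 1 ^ 4 * X 2 ^ 2 * X 3 ^ 2 : MvPolynomial (Fin 4) K) ∈ (Ideal.span {(X 0 : MvPolynomial (Fin 4) K), X 1}) ^ 4 ∧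
        ∀ H : MvPolynomial (Fin 4) K, (X 0 ^ 3 + X 2 * (X 1 ^ 4 * H) : MvPolynomial (Fin 4) K) ∈
          (Ideal.span {(X 0 : MvPolynomial (Fin 4) K), X 1, X 2, X 3}) ^ 3) ∧
    -- (L) the line: top, line, wild, near
      ((X 0 ^ 3 + X 1 ^ 4 * X 2 ^ 2 * X 3 ^ 2 : MvPolynomial (Fin 4) K) ∈ (Ideal.span {(X 0 : MvPolynomial (Fin 4) K), X 2, X 3}) ^ 3 ∧
        (X 1 : MvPolynomial (Fin 4) K) ∉ Ideal.span {(X 0 : MvPolynomial (Fin 4) K), X 2, X 3} ∧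
        (X 1 ^ 4 * X 2 ^ 2 * X 3 ^ 2 : MvPolynomial (Fin 4) K) ∈ (Ideal.span {(X 0 : MvPolynomial (Fin 4) K), X 2, X 3}) ^ 4 ∧
        ∀ H : MvPolynomial (Fin 4) K, (X 0 ^ 3 + X 2 * (H * X 3 ^ 2) : MvPolynomial (Fin 4) K) ∈
          (Ideal.span {(X 0 : MvPolynomial (Fin 4) K), X 1, X 2, X 3}) ^ 3) ∧
    -- (F) closure not regular at the origin
      ((X 1 * X 2 : MvPolynomial (Fin 4) K) ∈
          Ideal.span {(X 0 : MvPolynomial (Fin 4) K), X 1} ⊓ Ideal.span {(X 0 : MvPolynomial (Fin 4) K), X 2, X 3} ∧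
        (X 1 : MvPolynomial (Fin 4) K) ∉
          Ideal.span {(X 0 : MvPolynomial (Fin 4) K), X 1} ⊓ Ideal.span {(X 0 : MvPolynomial (Fin 4) K), X 2, X 3} ∧
        (X 2 : MvPolynomial (Fin 4) K) ∉
          Ideal.span {(X 0 : MvPolynomial (Fin 4) K), X 1} ⊓ Ideal.span {(X 0 : MvPolynomial (Fin 4) K), X 2, X 3}) ∧
    -- (S) Sing(closure) = the origin
      Ideal.span {(X 0 : MvPolynomial (Fin 4) K), X 1} ⊔ Ideal.span {(X 0 : MvPolynomial (Fin 4) K), X 2, X 3} =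
        Ideal.span {(X 0 : MvPolynomial (Fin 4) K), X 1, X 2, X 3} :=
  ⟨fun 𝔮 _ _ hs h => G0_top 𝔮 hs h, G0_plane, G0_line, G0_closure_not_prime, G0_sing_closure⟩

end GCertificatesA

end Summit.ResolutionOfSingularities.ResolutionOfSingularities.Theorems.DeltaCutClasses
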